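import Summits.ABC.IUTFork.Cor312UnitCountermodel
import Summits.ABC.IUTFork.Cor312UnitCosetPackage
import Summits.ABC.IUTFork.Cor312UnitCosetBarrier
import Mathlib.Tactic.NormNum.Prime
import HarnessLib

/-!
# [IUTchIII] Cor. 3.12 — the UNIT / COSET test models with CONTENTFUL Theorem 3.11 (iii) (c)/(d): proper, stabilized poly-isomorphisms

Record-only file (D-0012; MODEL DATA `pairIso`/`firstFactor`/`contentfulLink`/`uFullC`/`cFullC`, then proofs; no `Prop` fact) of the
abc-iut cell (wave-4 prover abc-iut-w4-d101, gen 4). TAKES NO SIDE on [IUTchIII] Cor. 3.12. It lifts the last INTERFACE-LEVEL degeneracy of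
abc-iut-w5-d161's clause census (STATUS 2026-08-26T05:19:50Z, item C5; VERDICT v3.0 draft rev 11 §[A] «REMAINING: … (iii)(c)/(d) over full
poly-isomorphisms»): in every model of record the permutation-symmetry poly-isomorphisms `ⁿ˒°ℜ ⥲ ⁿ⁺¹˒°ℜ` (`Thm311.LinkData.permR`) and the
κ-sol data poly-isomorphisms (`permM`) are FULL, so the stabilization clauses of c312-1's `PartIIIc`/`PartIIId` ([IUTchIII] Thm. 3.11 (iii) (c),
(d), kurims `paper:url-4b091feeb646` p. 157 l. 20 – p. 158 l. 15: «stabilized/equivariant/functorial with respect to arbitrary automorphisms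
of the domain and codomain») hold for free (`Thm311.PolyIsoCalc.stabilized_full`). Here:
* `contentfulLink` — link data over the one-object groupoid of `ℤˣ × ℤˣ`: Kummer isomorphism `κ_{n,m} = ((−1)^{|m|}, 1)`, natural isomorphism
  `(−1, 1)`, theater automorphisms `ℤˣ` acting through the FIRST factor, and `permR n = permM n = firstFactor` — the PROPER poly-isomorphism
  `{(±1, 1)}` (`firstFactor_ne_full`: `(1, −1) ∉`); (iii)(c): equivariance is an abelian commutation and STABILIZATION IS A GENUINE CLOSURE
  PROPERTY of the first factor (`contentfulLink_partIIIc`); (iii)(d) likewise;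
* `uFullC p` / `cFullC p` — the unit situation `UnitWitness.uFull` (p429309) and the coset situation `UnitCoset.cFull` (p431339) with this link
  data: **`uFullC_statement` / `cFullC_statement`** — the typed [IUTchIII] Theorem 3.11 (i) ∧ (ii) ∧ (iii) holds;
* the countermodels UNCHANGED on the Cor. 3.12 side (the settings read the situation, not the link data): `unitC_countermodel`,
  `cosetC_countermodel` — typed Thm 3.11 ∧ BridgeHyps ∧ AbsLogQPos ∧ THREE PINS ∧ ¬S ∧ ¬`PilotKummerCompat` ∧ ¬GapH3 ∧ ¬Statement, now with
  `permR`, `permM` PROPER and non-identity theater automorphisms.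
Interface-level, one place (`toyIndex`); not a model of initial Θ-data; no judgement on print. [claim: Mochizuki2012, status: disputed]
-/

noncomputable section

namespace Summit.ABC.IUTFork.Cor312Vol.UnitWitness

open Set Thm311 Cor312 Cor312.Checks Cor312.IdentifiedNonVacuity NaiveWitness PinnedWitness Literature.IUT.LogThetaLattice
open CategoryTheory Literature.IUT.HodgeTheaters

/-! ## 1. Link data with PROPER stabilized poly-isomorphisms -/

/-- The isomorphism of the one-object groupoid of `ℤˣ × ℤˣ` given by an element. [folklore] -/
def pairIso (g : ℤˣ × ℤˣ) : (SingleObj.star (ℤˣ × ℤˣ)) ≅ (SingleObj.star (ℤˣ × ℤˣ)) where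
  hom := g
  inv := (g⁻¹ : ℤˣ × ℤˣ)
  hom_inv_id := by rw [SingleObj.comp_as_mul]; exact inv_mul_cancel g
  inv_hom_id := by rw [SingleObj.comp_as_mul]; exact mul_inv_cancel g

/-- Composition of such isomorphisms is (reversed) multiplication. [folklore] -/
theorem pairIso_trans (g h : ℤˣ × ℤˣ) : pairIso g ≪≫ pairIso h = pairIso (h * g) := Iso.ext rfl

/-- `pairIso` is injective. [folklore] -/
theorem pairIso_injective : Function.Injective pairIso := fun _ _ h => congrArg Iso.hom h

/-- **The PROPER poly-isomorphism `{(ε, 1) | ε = ±1}`** — the first-factor sign subgroup as a set of isomorphisms.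
[claim: Mochizuki2012, status: disputed] -/
def firstFactor : PolyIso (SingleObj.star (ℤˣ × ℤˣ)) (SingleObj.star (ℤˣ × ℤˣ)) := {f | ∃ s : ℤˣ, f = pairIso (s, 1)}

/-- `firstFactor` is NOT the full poly-isomorphism: `(1, −1)` is missing. [folklore] -/
theorem firstFactor_ne_full : firstFactor ≠ PolyIso.full _ _ := by
  intro h
  have hmem : pairIso (1, -1) ∈ firstFactor := by rw [h]; exact Set.mem_univ _
  obtain ⟨s, hs⟩ := hmem
  have h2 : ((1 : ℤˣ), (-1 : ℤˣ)) = (s, 1) := congrArg Iso.hom hs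
  have h3 : (-1 : ℤˣ) = 1 := congrArg Prod.snd h2
  exact absurd h3 (by decide)

/-- `firstFactor` is STABILIZED by the first-factor automorphisms on both sides — a genuine closure property (`ℤˣ = {±1}`). [folklore] -/
theorem firstFactor_stabilized :
    PolyIsoCalc.Stabilized firstFactor {f | ∃ a : ℤˣ, f = pairIso (a, 1)} {g | ∃ b : ℤˣ, g = pairIso (b, 1)} := by
  rintro _ ⟨a, rfl⟩ _ ⟨b, rfl⟩ _ ⟨s, rfl⟩
  refine ⟨b * s * a, ?_⟩
  rw [pairIso_trans, pairIso_trans, Prod.mk_mul_mk, Prod.mk_mul_mk, mul_one, mul_one, mul_assoc]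

/-- **The CONTENTFUL link data** ([IUTchIII] Thm. 3.11 (iii)) over the one-object groupoid of `ℤˣ × ℤˣ`: Kummer isomorphism
`κ_{n,m} := ((−1)^{|m|}, 1)`, natural isomorphism `(−1, 1)`, permutation-symmetry / κ-sol poly-isomorphisms the PROPER `firstFactor`,
theater automorphisms `ℤˣ` acting through the first factor. [claim: Mochizuki2012, status: disputed] -/
def contentfulLink : LinkData where
  Strip := SingleObj (ℤˣ × ℤˣ)
  Fdelta := fun _ _ => SingleObj.star _
  FdeltaD := fun _ => SingleObj.star _
  kumDelta := fun _ m => pairIso ((-1) ^ m.natAbs, 1)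
  FenvD := fun _ => SingleObj.star _
  natEnvD := fun _ => pairIso (-1, 1)
  Rad := SingleObj (ℤˣ × ℤˣ)
  R := fun _ => SingleObj.star _
  permR := fun _ => firstFactor
  Kap := SingleObj (ℤˣ × ℤˣ)
  Mk := fun _ => SingleObj.star _
  permM := fun _ => firstFactor
  AutHT := fun _ _ => ℤˣ
  onDelta := fun _ _ a => pairIso (a, 1)
  onDeltaD := fun _ _ a => pairIso (a, 1)
  onR := fun _ _ a => pairIso (a, 1)
  onM := fun _ _ a => pairIso (a, 1)

/-- **(iii) (c) holds CONTENTFULLY**: the Kummer isomorphism is equivariant (an abelian commutation) and the PROPER poly-isomorphism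
`firstFactor` is stabilized by the induced automorphisms. [folklore] -/
theorem contentfulLink_partIIIc : contentfulLink.PartIIIc := fun n m => by
  refine ⟨?_, firstFactor_stabilized⟩
  rintro _ ⟨a, rfl⟩
  show pairIso (a, 1) ≪≫ pairIso ((-1) ^ m.natAbs, 1) = pairIso ((-1) ^ m.natAbs, 1) ≪≫ pairIso (a, 1)
  rw [pairIso_trans, pairIso_trans, mul_comm]

/-- **(iii) (d) holds CONTENTFULLY** (stabilization of the proper `permM`). [folklore] -/
theorem contentfulLink_partIIId : contentfulLink.PartIIId := fun _ _ => firstFactor_stabilized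

/-- The poly-isomorphisms of the contentful link data are proper, and the theater automorphism `−1` acts by a non-identity
isomorphism. [folklore] -/
theorem contentfulLink_proper :
    (∀ n, contentfulLink.permR n ≠ PolyIso.full _ _) ∧ (∀ n, contentfulLink.permM n ≠ PolyIso.full _ _) ∧
      ∀ n m, ∃ a : contentfulLink.AutHT n m, contentfulLink.onR n m a ≠ Iso.refl _ :=
  ⟨fun _ => firstFactor_ne_full, fun _ => firstFactor_ne_full, fun _ _ => ⟨(-1 : ℤˣ), fun h => by
    have h2 : ((-1 : ℤˣ), (1 : ℤˣ)) = (1 : ℤˣ × ℤˣ) := congrArg Iso.hom h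
    exact absurd (congrArg Prod.fst h2) (by decide)⟩⟩

/-! ## 2. The unit situation with the contentful link data -/

variable (p : ℕ) [hp : Fact p.Prime]

/-- **The unit full situation with CONTENTFUL (iii)**: `uFull p`'s lattice situation, link data `contentfulLink`. [claim: Mochizuki2012, status: disputed] -/
def uFullC : FullSituation toyIndex where
  toLatticeSituation := (uFull p).toLatticeSituation
  link := contentfulLink

/-- **The typed [IUTchIII] Theorem 3.11 (i) ∧ (ii) ∧ (iii) holds** for `uFullC p` — (iii)(c)/(d) no longer over full poly-isomorphisms. [folklore] -/
theorem uFullC_statement : (uFullC p).Statement :=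
  ⟨u_partI p, u_partII p, contentfulLink.partIIIa_holds, contentfulLink.partIIIb_holds, contentfulLink_partIIIc, contentfulLink_partIIId,
    (uFullC p).evalCompatUpToInd_of_multiradialCompat (u_multiradialCompat p)⟩

/-- **The UNIT countermodel with contentful (iii)** (`p = 2`): as `unit_countermodel`, over `uFullC`. [folklore] -/
theorem unitC_countermodel :
    ∃ (T : ThetaIndex) (F : FullSituation T) (P : Setting F.toLatticeSituation.toSituation)
      (ρ : (∀ v : T.V, v ∈ T.Vbad → Set (F.L.StarPacket v)) → ∀ (j : T.Label) (vQ : T.VQ), Set (F.L.Packet j vQ))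
      (qK : ∀ v : T.V, v ∈ T.Vbad → Set (F.L.StarPacket v)),
      F.Statement ∧ BridgeHyps P ∧ P.AbsLogQPos ∧ PinnedRegions3 F.toLatticeSituation P ρ qK ∧
      ¬ PilotKummerIndRelated F.toLatticeSituation P ρ qK ∧ ¬ PilotKummerCompat F.toLatticeSituation P qK ∧
      ¬ GapH3 F.toLatticeSituation P ρ qK ∧ ¬ P.Statement ∧
      (∀ n, F.link.permR n ≠ PolyIso.full _ _) ∧ (∀ n, F.link.permM n ≠ PolyIso.full _ _) ∧
      (∀ n m, ∃ a : F.link.AutHT n m, F.link.onR n m a ≠ Iso.refl _) ∧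
      (∀ n n' : ℤ, F.D n = F.D n' → n = n') ∧ (Setting.indGroup F.toSituation : Set F.L.PacketAut).Infinite := by
  haveI : Fact (Nat.Prime 2) := ⟨Nat.prime_two⟩
  exact ⟨toyIndex, uFullC 2, uSetting 2, orbitRegion 2, qDatum 2, uFullC_statement 2, uSetting_bridgeHyps 2, uSetting_absLogQPos 2,
    uSetting_pinnedRegions3 2, uSetting_not_pilotKummerIndRelated 2, uSetting_not_pilotKummerCompat 2, uSetting_not_gapH3 2,
    uSetting_not_statement 2, contentfulLink_proper.1, contentfulLink_proper.2.1, contentfulLink_proper.2.2, uFull_lines_distinct 2,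
    indClosure_infinite 2⟩

end Summit.ABC.IUTFork.Cor312Vol.UnitWitness

namespace Summit.ABC.IUTFork.Cor312Vol.UnitCoset

open Set Thm311 Cor312 Cor312.Checks Cor312.IdentifiedNonVacuity NaiveWitness PinnedWitness UnitWitness Literature.IUT.LogThetaLattice
open CategoryTheory Literature.IUT.HodgeTheaters

variable (p : ℕ) [hp : Fact p.Prime]

/-! ## 3. The coset situation with the contentful link data -/

/-- **The coset full situation with CONTENTFUL (iii)**. [claim: Mochizuki2012, status: disputed] -/
def cFullC : FullSituation toyIndex where
  toLatticeSituation := (cFull p).toLatticeSituation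
  link := contentfulLink

/-- **The typed Theorem 3.11 holds** for `cFullC p`. [folklore] -/
theorem cFullC_statement : (cFullC p).Statement :=
  ⟨c_partI p, c_partII p, contentfulLink.partIIIa_holds, contentfulLink.partIIIb_holds, contentfulLink_partIIIc, contentfulLink_partIIId,
    (cFullC p).evalCompatUpToInd_of_multiradialCompat (c_multiradialCompat p)⟩

/-- **The COSET countermodel with contentful (iii)** (`p = 7`): moved Θ-regions, strict hull inflation, proper stabilized poly-isomorphisms,
three pins, and ¬S for every q-pinned q-datum. [folklore] -/
theorem cosetC_countermodel :
    ∃ (T : ThetaIndex) (F : FullSituation T) (P : Setting F.toLatticeSituation.toSituation)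
      (ρ : (∀ v : T.V, v ∈ T.Vbad → Set (F.L.StarPacket v)) → ∀ (j : T.Label) (vQ : T.VQ), Set (F.L.Packet j vQ))
      (qK : ∀ v : T.V, v ∈ T.Vbad → Set (F.L.StarPacket v)),
      F.Statement ∧ BridgeHyps P ∧ P.AbsLogQPos ∧ PinnedRegions3 F.toLatticeSituation P ρ qK ∧
      ¬ PilotKummerIndRelated F.toLatticeSituation P ρ qK ∧ ¬ PilotKummerCompat F.toLatticeSituation P qK ∧
      ¬ GapH3 F.toLatticeSituation P ρ qK ∧ ¬ P.Statement ∧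
      (∀ n, F.link.permR n ≠ PolyIso.full _ _) ∧ (∀ n m, ∃ a : F.link.AutHT n m, F.link.onR n m a ≠ Iso.refl _) ∧
      (∃ (j : T.Label) (vQ : T.VQ), ∃ Φ ∈ Setting.indGroup F.toSituation, Φ j vQ '' P.thetaRegion3 j vQ ≠ P.thetaRegion3 j vQ) ∧
      (∀ qK', QPinned F.toLatticeSituation P ρ qK' → ¬ PilotKummerIndRelated F.toLatticeSituation P ρ qK') := by
  haveI : Fact (Nat.Prime 7) := ⟨by norm_num⟩
  refine ⟨toyIndex, cFullC 7, cSetting 7, cosetRegion 7, idealDatum 7, cFullC_statement 7, cSetting_bridgeHyps 7, cSetting_absLogQPos 7,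
    cSetting_pinnedRegions3 7, cSetting_not_pilotKummerIndRelated 7, cSetting_not_pilotKummerCompat 7, (cSetting_not_gapH3 7).2,
    cSetting_not_statement 7, contentfulLink_proper.1, contentfulLink_proper.2.2, ?_, fun qK' hq => ?_⟩
  · obtain ⟨Φ, hΦ, -, hne⟩ := possibleImages_moved 7 le_rfl ()
    exact ⟨1, (), Φ, hΦ, hne⟩
  · exact not_pilotKummerIndRelated_of_qPinned 7 (cSetting 7) (fun j vQ H hH => by obtain ⟨k, rfl⟩ := hH; exact ⟨k, rfl⟩) qK' hq

end Summit.ABC.IUTFork.Cor312Vol.UnitCoset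

end
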